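import Summits.ResolutionOfSingularities.ResolutionOfSingularities.Theorems.MarkedTransferCampaignW36SupplyTAB
import Literature.AlgebraicGeometry.Resolution.SymbolicPowersMonomialVeronese
import Literature.AlgebraicGeometry.Hironaka2017.Lib.WeightedOrderSpanX
import HarnessLib

/-!
# [L1 W3.6 · T-B kernel] Herzog–Hibi–Trung Cor. 2.2 for coordinate primes is a THEOREM; hence T-B `VeroneseOfMonomialCut_ours p`,
# T-AB `VeroneseOfLCIOrMonomialCut_ours p` and the W3.6 DOOR «`U30_2_R2_inst`|𝒞» hold UNCONDITIONALLY (no named fact left)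

Cell `res-hironaka`, rung L, slot W3.6 «ord-pow cut» (director-resolution g3 DOOR OF RECORD 2026-08-27T02:23:55Z, WAKE 02:54:25Z /
02:54:48Z: «s36-pv-1 := T-B `CampaignW36.VeroneseOfMonomialCut_ours p`»), seat res-L1-s36-pv-1. HOST item
stmt-ResolutionOfSingularities-16155 via `--supports`. HONEST FRAMING (D-0012/D-0089): kernel theorems about OUR typed objects
(res-type-010's order-defined `S06BaseHike.diffPower`, o4's classes and Props of p488503); nothing printed in [Hironaka2017] is asserted
and the manuscript stays «under review» (it prints no existence argument for `Ě`, p.30 l.4–9). AI-produced kernel proofs with standard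
axioms; weaker than expert review of the surrounding programme.

WHAT THIS FILE ADDS. res-L1-s36-pv-2's chain (`…W36DiffPowerStalks` p492546, `…W36RsopVeronese` p493137, `…W36SupplyTAB` p493656)
proved T-AB, T-B and the door MODULO ONE named published fact, F-W36-B1 = `Literature.RingTheory.MvPolynomial.HerzogHibiTrung2007_Cor2_2`
(Herzog–Hibi–Trung 2007 Cor. 2.2 for ARBITRARY monomial ideals). The door only ever applies that fact to families of COORDINATE PRIMES
`(X_i : i ∈ S)`, `S ∈ 𝒮` — and for those the statement is now a kernel theorem of the tree:
`Literature/Combinatorics/Optimization/CoverMonoidVeronese.lean` (p492382: the cover monoid `{(c, n) | ∀ S ∈ 𝒮, n ≤ ∑_{i∈S} c_i}` is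
finitely generated — Gordan, via Mathlib's `AddSubmonoid.fg_eqLocusM` — and has a standard Veronese level, HHT Thm. 2.1 (a) ⇒ (b)) and
`Literature/AlgebraicGeometry/Resolution/SymbolicPowersMonomialVeronese.lean` (p494285: `⋂_S 𝔭_S^n` is the monomial ideal on `E_n(𝒮)`
for any family `u` with Cossart–Piltant's hypothesis (H), hence `⋂_S 𝔭_S^{k b₀} ≤ (⋂_S 𝔭_S^{b₀})^k`; in particular for a regular system of
parameters, `iInf_pow_span_image_veronese_rsop`). So:
* `CampaignW36.mul_mem_span_X_image` — (H) for the variables of `K[X_1, …, X_n]`; **`exists_poly_veronese_holds`** — pv-2's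
  `exists_poly_veronese` WITHOUT the fact (same statement); `hht_Cor2_2_span_X` — F-W36-B1's conclusion for coordinate primes, AS A THEOREM;
* **`exists_uniform_rsop_veronese_holds`** — pv-2's export `exists_uniform_rsop_veronese` WITHOUT the fact (and without the `K`-algebra
  structure: the level depends only on the bound `N` on the embedding dimension), directly in the regular local ring (no flatness needed);
* **`veroneseOfLCIOrMonomialCutOn_holds`** (T-AB), **`veroneseOfMonomialCutOn_holds`** (T-B), the director's `p`-slices
  **`veroneseOfLCIOrMonomialCut_ours_holds p`**, **`veroneseOfMonomialCut_ours_holds p`** — UNCONDITIONAL (pv-2's stalkwise glue verbatim,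
  with the ring-level input supplied by the theorem instead of the fact);
* the DOOR, binder-free: `coreFocusExistsOn_lciOrMonomial_of_hatUscCutOn` (⟨UscCut⟩|𝒞 ⇒ `CoreFocusExistsOn LCIOrMonomialClass`),
  `coreFocusExistsOn_lciOrMonomial_of_invmaxClosed''`, **`campaignW36CoreFocusExists_lciOrMonomial_holds p :
  CampaignW36CoreFocusExistsOnI LCIOrMonomialClass p`** for every prime `p` — o4's one-screen composition (p488503 l.305) ∘ res-type-076's
  `campaignW31UscInvOneExponentI_holds` (W3.1, p491140) ∘ T-AB; and the B-type slices.
NET for the register: «`U30_2_R2_inst`|𝒞» (a core focusing `Ě` of `Ê` exists whenever `Σ̄_max(Ê)` is, at each of its points, a local complete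
intersection or a reduced union of coordinate subspaces of a regular system of parameters) is a CLOSED KERNEL THEOREM for every prime `p`,
every perfect field of characteristic `p`, every ambient datum — no named premise. The general fact F-W36-B1 (arbitrary monomial ideals) stays
in the tree as a Literature fact but is OFF the W3.6 critical path.
-/

noncomputable section

set_option linter.dupNamespace false -- mandated namespace of this single-conjunct summit

open _root_.AlgebraicGeometry _root_.TopologicalSpace _root_.CategoryTheory _root_.IsLocalRing _root_.MvPolynomial

namespace Summit.ResolutionOfSingularities.ResolutionOfSingularities.Theorems

open Literature.AlgebraicGeometry.Resolution
open Literature.AlgebraicGeometry.Hironaka2017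
open Literature.AlgebraicGeometry.Hironaka2017.S02Preliminaries
open Literature.AlgebraicGeometry.Hironaka2017.S04CharAlgebra
open Literature.AlgebraicGeometry.Hironaka2017.S06BaseHike
open Literature.AlgebraicGeometry.Hironaka2017.Datum
open Literature.Combinatorics.Optimization.CoverMonoid
open Scheme.IdealSheafData

universe u

namespace CampaignW36

/-! ## Herzog–Hibi–Trung Cor. 2.2 for coordinate primes in `K[X_1, …, X_n]` — a theorem -/

section Poly

variable (K : Type u) [Field K]

/-- Hypothesis (H) of the monomial calculus for the VARIABLES of a polynomial ring over a field: `X_i` is a non-zero-divisor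
modulo `(X_t : t ∈ T)` for `i ∉ T` (the ideal is prime and does not contain `X_i`). [cite: ZariskiSamuel1960, Vol. II Ch. VII §1 (graded rings; ideals generated by variables)] -/
theorem mul_mem_span_X_image (n : ℕ) :
    ∀ (i : Fin n) (T : Finset (Fin n)), i ∉ T → ∀ y : MvPolynomial (Fin n) K,
      X i * y ∈ Ideal.span (X '' (T : Set (Fin n))) → y ∈ Ideal.span (X '' (T : Set (Fin n))) := by
  intro i T hiT y hy
  have hP := Literature.AlgebraicGeometry.Hironaka2017.SpanXValuation.isPrime_span_X (K := K) (σ := Fin n) (T : Set (Fin n))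
  refine (hP.mem_or_mem hy).resolve_left fun hX => hiT ?_
  rw [mem_ideal_span_X_image] at hX
  obtain ⟨j, hj, hne⟩ := hX (Finsupp.single i 1) (by rw [support_X]; exact Finset.mem_singleton_self _)
  have hji : j = i := by
    by_contra h
    exact hne (Finsupp.single_eq_of_ne h)
  exact Finset.mem_coe.mp (hji ▸ hj)

/-- **res-L1-s36-pv-2's `exists_poly_veronese` WITHOUT the fact**: for every finite family `𝒮` of subsets of `Fin d`, some `δ > 0` is a
Veronese level of the coordinate-prime family `((X_i : i ∈ S))_{S ∈ 𝒮}` of `K[X_1, …, X_d]`: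
`⨅_S (X_S)^{k δ} ≤ (⨅_S (X_S)^δ)^k` for all `k` — Herzog–Hibi–Trung Cor. 2.2 for coordinate primes, PROVED (Gordan + HHT Thm. 2.1 via the
cover monoid). [cite: HerzogHibiTrung2007, Cor. 2.2] -/
theorem exists_poly_veronese_holds {d : ℕ} (𝒮 : Finset (Finset (Fin d))) :
    ∃ δ : ℕ, 0 < δ ∧ ∀ k : ℕ,
      (𝒮.inf fun S => (Ideal.span (X '' (S : Set (Fin d))) : Ideal (MvPolynomial (Fin d) K)) ^ (k * δ)) ≤
        (𝒮.inf fun S => Ideal.span (X '' (S : Set (Fin d))) ^ δ) ^ k := by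
  obtain ⟨δ, hδ, h⟩ := exists_iInf_pow_span_image_veronese (X : Fin d → MvPolynomial (Fin d) K) (mul_mem_span_X_image K d) 𝒮
  refine ⟨δ, hδ, fun k => ?_⟩
  rw [Finset.inf_eq_iInf, Finset.inf_eq_iInf]
  exact h k

/-- **F-W36-B1's conclusion for COORDINATE PRIMES, as a theorem**: for monomial prime ideals `I_S = (X_i : i ∈ S)`, `S ∈ 𝒮`, of
`K[X_1, …, X_d]` there is `δ > 0` with `(⋂_S I_S^δ)^k = ⋂_S I_S^{δ k}` for all `k` (Herzog–Hibi–Trung 2007, Cor. 2.2, the case the W3.6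
door uses; the general monomial-ideal fact `Literature.RingTheory.MvPolynomial.HerzogHibiTrung2007_Cor2_2` is not needed for it).
[cite: HerzogHibiTrung2007, Cor. 2.2] -/
theorem hht_Cor2_2_span_X {d : ℕ} (𝒮 : Finset (Finset (Fin d))) :
    ∃ δ : ℕ, 0 < δ ∧ ∀ k : ℕ,
      (𝒮.inf fun S => (Ideal.span (X '' (S : Set (Fin d))) : Ideal (MvPolynomial (Fin d) K)) ^ δ) ^ k =
        𝒮.inf fun S => Ideal.span (X '' (S : Set (Fin d))) ^ (δ * k) := by
  obtain ⟨δ, hδ, h⟩ := exists_poly_veronese_holds K 𝒮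
  refine ⟨δ, hδ, fun k => le_antisymm ?_ ?_⟩
  · rw [mul_comm]
    exact finsetInf_pow_pow_le 𝒮 _ δ k
  · rw [mul_comm]
    exact h k

end Poly

/-! ## The uniform ring-level Veronese property at r.s.p. points — a theorem -/

/-- **res-L1-s36-pv-2's export `exists_uniform_rsop_veronese` WITHOUT the fact**: for every bound `N` there is `b₀ > 0` such that for every
regular local ring `R` with `emb dim R = d ≤ N`, every regular system of parameters `z` of `R`, every finite family `𝒮` of subsets of the
parameters and every `k`: `⨅_{S ∈ 𝒮} (z_S)^{k b₀} ≤ (⨅_{S ∈ 𝒮} (z_S)^{b₀})^k`. Proof: `b₀` = the product of the standard Veronese levels of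
the (finitely many) cover monoids on at most `N` letters (`CoverMonoid.exists_veronese_level`, multiples stay good `veronese_level_mul`), and
the monomial calculus of a regular system of parameters (`iInf_pow_span_image_veronese_rsop`) — no base field, no flatness.
[cite: HerzogHibiTrung2007, Cor. 2.2] [cite: CossartPiltant2019, Prop. 2.1 (arXiv v1 p. 10)] [cite: Matsumura1987, Thm. 16.2 (ii)] -/
theorem exists_uniform_rsop_veronese_holds (N : ℕ) :
    ∃ b₀ : ℕ, 0 < b₀ ∧ ∀ (R : Type u) [CommRing R] [IsRegularLocalRing R] (d : ℕ), d ≤ N →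
      ∀ (_ : (maximalIdeal R).spanFinrank = d) (z : Fin d → R) (_ : Ideal.span (Set.range z) = maximalIdeal R)
        (𝒮 : Finset (Finset (Fin d))) (k : ℕ),
        (𝒮.inf fun S => Ideal.span (z '' (S : Set (Fin d))) ^ (k * b₀)) ≤
          (𝒮.inf fun S => Ideal.span (z '' (S : Set (Fin d))) ^ b₀) ^ k := by
  classical
  choose δ hδpos hδ using fun (d : ℕ) (𝒮 : Finset (Finset (Fin d))) => exists_veronese_level 𝒮
  refine ⟨∏ d ∈ Finset.range (N + 1), ∏ 𝒮 : Finset (Finset (Fin d)), δ d 𝒮, ?_, ?_⟩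
  · exact Finset.prod_pos fun d _ => Finset.prod_pos fun 𝒮 _ => hδpos d 𝒮
  · intro R _ _ d hdN hd z hz 𝒮 k
    have hdvd : δ d 𝒮 ∣ ∏ d' ∈ Finset.range (N + 1), ∏ 𝒮' : Finset (Finset (Fin d')), δ d' 𝒮' :=
      (Finset.dvd_prod_of_mem _ (Finset.mem_univ 𝒮)).trans
        (Finset.dvd_prod_of_mem (fun d' => ∏ 𝒮' : Finset (Finset (Fin d')), δ d' 𝒮')
          (Finset.mem_range.mpr (Nat.lt_succ_of_le hdN)))
    obtain ⟨m, hm⟩ := hdvd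
    rw [hm, mul_comm (δ d 𝒮) m, Finset.inf_eq_iInf, Finset.inf_eq_iInf]
    exact iInf_pow_span_image_veronese_rsop hd z hz (veronese_level_mul (hδ d 𝒮) m) k

/-! ## T-AB and T-B HOLD -/

variable {p : ℕ} [Fact p.Prime] {K : Type u} [Field K] [CharP K p]

omit [Fact p.Prime] in
/-- The embedding dimension of a regular local ring of dimension `≤ N` is `≤ N`. [cite: Matsumura1987, §14 (regular local rings: emb dim = dim)] -/
private theorem spanFinrank_le_of_ringKrullDim_le' {R : Type u} [CommRing R] [IsRegularLocalRing R] {d N : ℕ}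
    (hd : (maximalIdeal R).spanFinrank = d) (hN : ringKrullDim R ≤ N) : d ≤ N := by
  -- adapted from Theorems/MarkedTransferCampaignW36SupplyTAB.lean (private)
  have h := IsRegularLocalRing.spanFinrank_maximalIdeal (R := R)
  rw [hd] at h
  have : ((d : ℕ∞) : WithBot ℕ∞) ≤ ((N : ℕ∞) : WithBot ℕ∞) := h.le.trans hN
  exact_mod_cast this

/-- **T-AB HOLDS: `CampaignW36.VeroneseOfLCIOrMonomialCutOn A`** for every ambient datum `A` — every closed `C ⊆ A.Z` that is A-type
(`IsLCICutAt`) or B-type (`IsMonomialCutAt`) at each of its points is Veronese-standard at some level `b₀ > 0`: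
`𝓘_C^{⟨k b₀⟩} ≤ (𝓘_C^{⟨b₀⟩})^k` for all `k`. res-L1-s36-pv-2's stalkwise glue (`diffPower_mul_le_pow_of_forall_stalk`,
`stalk_veronese_of_isWeaklyRegularAt`, `stalk_veronese_of_rsop`) with the uniform ring-level level of `exists_uniform_rsop_veronese_holds`
(a theorem) in place of the Herzog–Hibi–Trung fact. UNCONDITIONAL. NOT a statement of the manuscript.
[cite: HerzogHibiTrung2007, Cor. 2.2] [cite: Matsumura1987, Thm. 16.2] -/
theorem veroneseOfLCIOrMonomialCutOn_holds (A : AmbientDatum p K) : VeroneseOfLCIOrMonomialCutOn A := by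
  intro C hC
  haveI := A.smooth
  haveI := A.quasiCompact
  haveI := Scheme.isNoetherian_of_finiteType_over_field A.hom
  obtain ⟨N, hN⟩ := exists_nat_ringKrullDim_stalk_le A
  obtain ⟨b₀, hb₀, hV⟩ := exists_uniform_rsop_veronese_holds.{u} N
  refine ⟨b₀, hb₀, fun k => diffPower_mul_le_pow_of_forall_stalk C fun x hx => ?_⟩
  rcases hC x hx with hAx | hBx
  · obtain ⟨rs, hreg, hI⟩ := hAx
    exact stalk_veronese_of_isWeaklyRegularAt C ⟨rs, hreg.toIsWeaklyRegular, hI⟩ b₀ k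
  · obtain ⟨d, z, ⟨hreg, hz, hd⟩, 𝒮, h𝒮⟩ := hBx
    haveI := hreg
    have hC' : stalkIdeal (vanishingIdeal C) x = 𝒮.inf fun S => Ideal.span (z '' (S : Set (Fin d))) := by
      rw [h𝒮, Finset.inf_eq_iInf]
    exact stalk_veronese_of_rsop hd z hz 𝒮 hC'
      (hV _ d (spanFinrank_le_of_ringKrullDim_le' hd (hN x)) hd z hz 𝒮 k)

/-- **T-B HOLDS: `CampaignW36.VeroneseOfMonomialCutOn A`** for every ambient datum `A` (the everywhere-B-type special case of T-AB):
every closed `C ⊆ A.Z` that is, at each of its points, a reduced union of coordinate subspaces of a regular system of parameters is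
Veronese-standard at some level. UNCONDITIONAL. NOT a statement of the manuscript. [cite: HerzogHibiTrung2007, Cor. 2.2] -/
theorem veroneseOfMonomialCutOn_holds (A : AmbientDatum p K) : VeroneseOfMonomialCutOn A :=
  fun C hC => veroneseOfLCIOrMonomialCutOn_holds A C fun x hx => Or.inr (hC x hx)

/-! ## The door on the class `𝒞`, modulo ⟨UscCut⟩ (slot W3.1) only — and binder-free via W3.1's theorem -/

variable {IsEdgeData : ∀ ⦃X : Scheme.{u}⦄ ⦃p n : ℕ⦄ (E : IdealExponent X) (ξ : X), EdgeDatumAt p n E ξ → Prop}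
variable [PerfectField K] {A : AmbientDatum p K} {n : ℕ}

/-- **⟨UscCut⟩|𝒞 ⇒ `Ě` exists on THE DOOR'S CLASS `𝒞 = LCIOrMonomialClass`** — o4's `coreFocusExistsOn_lciOrMonomial_of_veronese`
(p488503 l.238) with T-AB DISCHARGED (`veroneseOfLCIOrMonomialCutOn_holds`); no fact. NOT a statement of the manuscript.
[cite: HerzogHibiTrung2007, Cor. 2.2] [cite: Matsumura1987, Thm. 16.2] -/
theorem coreFocusExistsOn_lciOrMonomial_of_hatUscCutOn (hU : HatUscCutOn LCIOrMonomialClass IsEdgeData A n) :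
    CoreFocusExistsOn LCIOrMonomialClass IsEdgeData A n :=
  coreFocusExistsOn_lciOrMonomial_of_veronese hU (veroneseOfLCIOrMonomialCutOn_holds A)

/-- **⟨UscCut⟩|B-type ⇒ `Ě` exists on the B-type class**, T-B discharged; no fact. NOT a statement of the manuscript.
[cite: HerzogHibiTrung2007, Cor. 2.2] -/
theorem coreFocusExistsOn_monomial_of_hatUscCutOn (hU : HatUscCutOn MonomialClass IsEdgeData A n) :
    CoreFocusExistsOn MonomialClass IsEdgeData A n :=
  coreFocusExistsOn_monomial_of_veroneseOfMonomialCutOn hU (veroneseOfMonomialCutOn_holds A)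

/-- **From the W3.1 statement `CampaignW31InvmaxClosed`: `Ě` exists on the door's class**, T-AB discharged; no fact. NOT a statement of
the manuscript. [cite: HerzogHibiTrung2007, Cor. 2.2] -/
theorem coreFocusExistsOn_lciOrMonomial_of_invmaxClosed'' (hW31 : CampaignW31InvmaxClosed.{u} IsEdgeData) :
    CoreFocusExistsOn LCIOrMonomialClass IsEdgeData A n :=
  coreFocusExistsOn_lciOrMonomial_of_invmaxClosed hW31 (veroneseOfLCIOrMonomialCutOn_holds A)

end CampaignW36

open CampaignW36

/-! ## The director's `p`-slices, UNCONDITIONAL -/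

/-- **T-AB, the director's `p`-slice, HOLDS: `VeroneseOfLCIOrMonomialCut_ours p`** for every prime `p` (every perfect — indeed every —
field `K` of characteristic `p`, every ambient datum). UNCONDITIONAL: the W3.6 skeleton's mixed-class supply is a theorem. NOT a statement
of the manuscript. [cite: HerzogHibiTrung2007, Cor. 2.2] [cite: Matsumura1987, Thm. 16.2] -/
theorem veroneseOfLCIOrMonomialCut_ours_holds (p : ℕ) [Fact p.Prime] : VeroneseOfLCIOrMonomialCut_ours.{u} p :=
  fun _K _ _ _ A => veroneseOfLCIOrMonomialCutOn_holds A

/-- **T-B, the director's `p`-slice, HOLDS: `VeroneseOfMonomialCut_ours p`** — «every everywhere-monomial closed subset of an ambient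
scheme is Veronese-standard at some level» (o4 p488503 l.276; the s36 seat's `stub_TB`). UNCONDITIONAL: Gordan (Mathlib
`AddSubmonoid.fg_eqLocusM`) + Herzog–Hibi–Trung Thm. 2.1 on the cover monoid, the monomial calculus of a regular system of parameters
(Cossart–Piltant Prop. 2.1, Matsumura 16.2 (ii)), and res-L1-s36-pv-2's stalk identification `(𝓘_C^{⟨b⟩})_x = ⋂_S (z_S)^b`. NOT a
statement of the manuscript. [cite: HerzogHibiTrung2007, Cor. 2.2] [cite: Matsumura1987, Thm. 16.2 (ii)] -/
theorem veroneseOfMonomialCut_ours_holds (p : ℕ) [Fact p.Prime] : VeroneseOfMonomialCut_ours.{u} p :=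
  fun _K _ _ _ A => veroneseOfMonomialCutOn_holds A

/-- **«`U30_2_R2_inst`|𝒞» modulo the W3.1 slot statement ONLY**: `CampaignW31UscInvOneExponentI p → CampaignW36CoreFocusExistsOnI
LCIOrMonomialClass p` (o4's one-screen composition p488503 l.305 with T-AB discharged). NOT a statement of the manuscript.
[cite: HerzogHibiTrung2007, Cor. 2.2] -/
theorem campaignW36CoreFocusExists_lciOrMonomial_of_usc (p : ℕ) [Fact p.Prime] (h₁ : CampaignW31UscInvOneExponentI.{u} p) :
    CampaignW36CoreFocusExistsOnI.{u} LCIOrMonomialClass p :=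
  campaignW36CoreFocusExists_lciOrMonomial_of_usc_of_veronese p h₁ (veroneseOfLCIOrMonomialCut_ours_holds p)

/-- **«`U30_2_R2_inst`|B-type» modulo the W3.1 slot statement ONLY.** NOT a statement of the manuscript. [cite: HerzogHibiTrung2007, Cor. 2.2] -/
theorem campaignW36CoreFocusExists_monomial_of_usc (p : ℕ) [Fact p.Prime] (h₁ : CampaignW31UscInvOneExponentI.{u} p) :
    CampaignW36CoreFocusExistsOnI.{u} MonomialClass p :=
  campaignW36CoreFocusExists_monomial_of_usc_of_veronese p h₁ (veroneseOfMonomialCut_ours_holds p)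

/-- **THE W3.6 DOOR «`U30_2_R2_inst`|𝒞» HOLDS, BINDER-FREE**: `CampaignW36CoreFocusExistsOnI LCIOrMonomialClass p` for every prime `p` — for
every perfect field `K` of characteristic `p`, every ambient datum, every `n` and every standard ideal exponent `E` with `0 < Ê.b` whose
`Inv_max`-stratum closure `Σ̄_max` is, at each of its points, a local complete intersection OR a reduced union of coordinate subspaces of a
regular system of parameters, a core focusing `Ě` of `Ê` exists (res-type-076's `campaignW36CoreFocusExists_lciOrMonomial_of_veronese`,
p491140, ∘ `veroneseOfLCIOrMonomialCut_ours_holds`). No named premise remains: res-L1-s36-pv-2's `campaignW36CoreFocusExists_lciOrMonomial_of_HHT`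
with its Herzog–Hibi–Trung hypothesis discharged for the coordinate-prime families it is applied to. CLASS-RESTRICTED honesty (register):
W3.6 is stated on 𝒞 only (S–T cones / space monomial curves excluded on the face of the class); this closes R12/12a's residual ON 𝒞 ONLY.
NOT a statement of the manuscript. [cite: HerzogHibiTrung2007, Cor. 2.2] [cite: Matsumura1987, Thm. 16.2, Thm. 23.1] -/
theorem campaignW36CoreFocusExists_lciOrMonomial_holds (p : ℕ) [Fact p.Prime] :
    CampaignW36CoreFocusExistsOnI.{u} LCIOrMonomialClass p :=
  campaignW36CoreFocusExists_lciOrMonomial_of_veronese p (veroneseOfLCIOrMonomialCut_ours_holds p)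

/-- **«`U30_2_R2_inst`|B-type» HOLDS, BINDER-FREE.** NOT a statement of the manuscript. [cite: HerzogHibiTrung2007, Cor. 2.2] -/
theorem campaignW36CoreFocusExists_monomial_holds (p : ℕ) [Fact p.Prime] :
    CampaignW36CoreFocusExistsOnI.{u} MonomialClass p :=
  campaignW36CoreFocusExists_monomial_of_veronese p (veroneseOfMonomialCut_ours_holds p)

end Summit.ResolutionOfSingularities.ResolutionOfSingularities.Theorems

end
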